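import Literature.Analysis.FluidPDE.PassiveScalar
import Literature.Analysis.FluidPDE.LerayHopf
import Literature.Analysis.FunctionSpaces.TorusSpaceTime
import HarnessLib

/-!
# Cheskidov's total-dissipation family (arXiv:2311.04182, §§3–4 and (6.2)–(6.4))

Topic `Literature/Analysis/FluidPDE` (trunk FluidKinetic, family `turb`, statement **turb.S12**).
The vendored fact `Literature.Analysis.FluidPDE.cheskidov_time_periodic_anomaly` (`ZerothLaw.lean`; Cheskidov 2023,
Thm. 1.3) is proved in the source (§6, pp. 18–19) by *periodising in time* a family of planar
objects constructed in §3 and analysed in §4: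

* viscosities `ν_m → 0` ((4.13): `ν_m = m^{5/2} λ_m^{-2}`, `λ_m = 5^m`);
* smooth divergence-free planar drifts `v^m ∈ C^∞(ℝ × T²; ℝ²)` — the time-glued, rescaled
  Alberti–Crippa–Mazzucato velocities `ṽ^m` of (3.4) on `[0,1)`, extended by zero for `t ≥ 1`
  (p. 12; `v^m(0) = 0` with all time derivatives, so the extension by zero to `t ≤ 0` is smooth as
  well), eventually independent of `m` on every `[0,T]`, `T < 1` (by (3.4), the stages `n ≤ m`
  are not modified when `m` grows), of zero mean (Bruè–De Lellis 2023, Thm. 4.1 (c):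
  divergence-free with compact support in the open unit square) and uniformly bounded in `L²`
  ((6.5); Thm. 3.1 (a) with `α = 0`);
* the unique smooth solutions `θ^m` ("`θ̃^m`" in §6) of the advection–diffusion equations
  `∂ₜθ^m + v^m·∇θ^m = ν_m Δθ^m` on `[0,2] × T²` with the common datum `ρ_in = ρ₁(0)`,
  `‖ρ_in‖_{L²} = 1`, of zero mean ((3.2), (4.2)); their `L²` energies are non-increasing (energy
  equality, p. 12);
* the **total dissipation anomaly** (6.4) (proved in §4, (4.3)–(4.12), (4.20), for the choice
  (4.13) of `ν_m`): `‖θ^m(1)‖_{L²} → 0` and `2ν_m ∫ₛ¹ ‖∇θ^m‖²_{L²} dt → 1` for every `s ∈ [0,1)`;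
* the inviscid profile `ρ̃ ∈ C^∞([0,1) × T²)` of (3.8) with
  `sup_{t ∈ [0,T]} ‖θ^m(t) - ρ̃(t)‖_{L²} → 0` for every `T < 1` ((4.5) together with
  `ρ^m = ρ̃` on `[0,T]` for `m` large, p. 18);
* the convergence of the planar Navier–Stokes body forces
  `g^m = ∂ₜv^m + (v^m·∇)v^m - ν_m Δv^m` ((3.13)) to the Euler force `g = ∂ₜṽ + (ṽ·∇)ṽ` ((3.11)),
  uniformly in time with values in `L²` (p. 10, after (3.13): `g^m → g` in `C([0,1]; C^α(T²))`,
  via Bruè–De Lellis 2023, Lemma 5.1; both sides vanish for `t ∉ (0,1)`), the limit being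
  continuous in time with values in `L²` and smooth in `x` at each fixed time.

This file vendors exactly this list as ONE named fact,
`Literature.Analysis.FluidPDE.cheskidov_total_dissipation_family` — the interface between §§3–4 (the
Alberti–Crippa–Mazzucato / Bruè–De Lellis core, shared with Thm. 2.1 of the source and with
`Literature.Analysis.FluidPDE.brue_deLellis_anomalous_dissipation`) and the periodisation argument of §6, which is to
be *proved* from it (`CheskidovPeriodisation.lean`, yielding `cheskidov_planar_anomaly` and hence
`cheskidov_time_periodic_anomaly`). A proof of the present fact has to supply the construction of
§3 from the quasi-self-similar family (`Literature.Analysis.FluidPDE.alberti_crippa_mazzucato_quasi_self_similar`,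
`QuasiSelfSimilarMixing.lean`), parabolic well-posedness
(`Torus.exists_unique_isClassicalScalarTransportForcedOn`, `PassiveScalarWellPosedness.lean`),
the energy estimates (4.3)–(4.5) and the Fourier splitting (4.6)–(4.12).

## Lean rendering

* Fields are time-first on `T² = UnitAddTorus (Fin 2)`; "smooth on `ℝ × T²`" is
  `Torus.IsSmoothSpaceTimeOn univ`, the advection–diffusion equation on `[0,2]` is the accepted
  `Torus.IsClassicalScalarTransportOn (Icc 0 2)` (one-sided time derivatives at `0` and `2`).
* The raw Navier–Stokes force generated by a velocity field is the definition
  `Torus.nsBodyForce ν v t = ∂ₜv(t) + (v(t)·∇)v(t) - νΔv(t)` ((3.13); two-sided time derivative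
  `timeDerivWithin univ`, the drifts living on all of `ℝ`).
* `L²` quantities: energies as `∫ θ²`, `∫ ‖v‖²`; `‖∇θ‖²_{L²} = Torus.scalarGradNormSq`;
  convergence "in `L^∞_t L²_x`" as `⨆ t, eLpNorm (·) 2 volume → 0` in `ℝ≥0∞` (the form used by
  `cheskidov_time_periodic_anomaly`); `C(ℝ; L²)` is `Torus.ContinuousInLpOn univ 2`.
* The sequence index `m : ℕ` is the source's `m` up to a shift (the source's `ν_0` would be `0`).

## References

* A. Cheskidov, *Dissipation anomaly and anomalous dissipation in incompressible fluid flows*,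
  arXiv:2311.04182 (2023): Thm. 3.1, (3.2)–(3.13) (pp. 10–11), §4 (4.2)–(4.13), (4.20)
  (pp. 12–13), §6 (6.2)–(6.5) (p. 18).
* E. Bruè, C. De Lellis, *Anomalous dissipation for the forced 3D Navier–Stokes equations*,
  Comm. Math. Phys. 400 (2023), Thm. 4.1 (c), §5 (5.1)–(5.4), Lemma 5.1.
-/

noncomputable section

open MeasureTheory Set Filter Topology
open scoped ENNReal

namespace Literature.Analysis.FluidPDE

namespace Torus

variable {d : Type*} [Fintype d]

/-- The **Navier–Stokes body force generated by a velocity field** `v` at viscosity `ν`: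
`nsBodyForce ν v t = ∂ₜv(t) + (v(t)·∇)v(t) - ν Δv(t)` (two-sided time derivative, `v` living
on all of `ℝ`), so that a smooth divergence-free `v` solves the Navier–Stokes system with
viscosity `ν`, zero pressure and exactly this force (Cheskidov 2023, (3.13):
`g^m := ∂ₜṽ^m + (ṽ^m·∇)ṽ^m - ν_m Δṽ^m`; Bruè–De Lellis 2023, (5.4)). [cite: Cheskidov2023, (3.13)] -/
def nsBodyForce (ν : ℝ) (v : ℝ → UnitAddTorus d → EuclideanSpace ℝ d) (t : ℝ)
    (x : UnitAddTorus d) : EuclideanSpace ℝ d :=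
  FunctionSpaces.Torus.timeDerivWithin univ v t x + FunctionSpaces.Torus.convect (v t) (v t) x - ν • FunctionSpaces.Torus.laplacian (v t) x

/-- Unfolding `nsBodyForce` (Cheskidov 2023, (3.13)). [cite: Cheskidov2023, (3.13)] -/
theorem nsBodyForce_apply (ν : ℝ) (v : ℝ → UnitAddTorus d → EuclideanSpace ℝ d) (t : ℝ)
    (x : UnitAddTorus d) :
    nsBodyForce ν v t x =
      FunctionSpaces.Torus.timeDerivWithin univ v t x + FunctionSpaces.Torus.convect (v t) (v t) x - ν • FunctionSpaces.Torus.laplacian (v t) x :=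
  rfl

/-- The Euler case: `nsBodyForce 0 v t = ∂ₜv(t) + (v(t)·∇)v(t)` (Cheskidov 2023, (3.11):
`g := ∂ₜṽ + (ṽ·∇)ṽ`). [cite: Cheskidov2023, (3.11)] -/
theorem nsBodyForce_zero (v : ℝ → UnitAddTorus d → EuclideanSpace ℝ d) (t : ℝ)
    (x : UnitAddTorus d) :
    nsBodyForce 0 v t x = FunctionSpaces.Torus.timeDerivWithin univ v t x + FunctionSpaces.Torus.convect (v t) (v t) x := by
  simp [nsBodyForce]

end Torus

section Turb

/-- **Cheskidov's total-dissipation family** (arXiv:2311.04182, §3 (3.2)–(3.13), §4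
(4.2)–(4.13), (4.20), §6 (6.2)–(6.5); the drifts are the glued Alberti–Crippa–Mazzucato /
Bruè–De Lellis velocities). There exist viscosities `ν_m > 0`, `ν_m → 0`; planar drifts
`v^m ∈ C^∞(ℝ × T²; ℝ²)`, divergence free and of zero mean at every time, vanishing for
`t ∉ (0,1)`, with `sup_{m,t} ‖v^m(t)‖²_{L²} ≤ B`, and eventually stationary on every `[0,T]`,
`T < 1` (`v^m(t) = v^{m₁}(t)` for `t ≤ T`, `m ≥ m₁`); a smooth mean-zero datum `ρ_in` with
`‖ρ_in‖²_{L²} = 1`; classical solutions `θ^m ∈ C^∞([0,2] × T²)` of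
`∂ₜθ^m + v^m·∇θ^m = ν_m Δθ^m` on `[0,2]` with `θ^m(0) = ρ_in`, of zero mean, with non-increasing
energy `t ↦ ‖θ^m(t)‖²_{L²}` on `[0,2]`; the **total dissipation anomaly** `‖θ^m(1)‖²_{L²} → 0`
and `2ν_m ∫ₛ¹ ‖∇θ^m(t)‖²_{L²} dt → 1` for every `s ∈ [0,1)`; an inviscid profile
`ρ̃ ∈ C^∞([0,1) × T²)` with `sup_{t ∈ [0,T]} ‖θ^m(t) - ρ̃(t)‖_{L²} → 0` for every `T ∈ [0,1)`;
and a limit force `g : ℝ → (T² → ℝ²)`, smooth in `x` at each time and continuous in time with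
values in `L²`, with `sup_{t ∈ ℝ} ‖g^m(t) - g(t)‖_{L²} → 0` for the Navier–Stokes forces
`g^m = ∂ₜv^m + (v^m·∇)v^m - ν_m Δv^m` (`Torus.nsBodyForce`). See the module docstring for the
clause-by-clause provenance. [cite: Cheskidov2023, §4 (4.2)–(4.13), (4.20) and §6 (6.2)–(6.5)] [cite: BrueDeLellisCMP2023, Thm. 4.1 (c), Lemma 5.1] -/
def cheskidov_total_dissipation_family : Prop :=
  ∃ (ν : ℕ → ℝ) (v : ℕ → ℝ → UnitAddTorus (Fin 2) → EuclideanSpace ℝ (Fin 2))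
      (ρin : UnitAddTorus (Fin 2) → ℝ) (θ : ℕ → ℝ → UnitAddTorus (Fin 2) → ℝ)
      (ρ : ℝ → UnitAddTorus (Fin 2) → ℝ) (g : ℝ → UnitAddTorus (Fin 2) → EuclideanSpace ℝ (Fin 2))
      (B : ℝ),
    -- viscosities (4.13)
    (∀ m, 0 < ν m) ∧ Tendsto ν atTop (𝓝 0) ∧
    -- the drifts (3.4), p. 12, (6.5)
    (∀ m, FunctionSpaces.Torus.IsSmoothSpaceTimeOn univ (v m)) ∧
    (∀ m t, FunctionSpaces.Torus.IsDivFree (v m t) ∧ FunctionSpaces.Torus.HasZeroMean (v m t)) ∧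
    (∀ m, ∀ t ∉ Ioo (0 : ℝ) 1, v m t = 0) ∧
    (∀ m t, ∫ x, ‖v m t x‖ ^ 2 ≤ B) ∧
    (∀ T < (1 : ℝ), ∃ m₁ : ℕ, ∀ m ≥ m₁, ∀ t ≤ T, v m t = v m₁ t) ∧
    -- the datum (3.2) and the scalars (4.2)
    FunctionSpaces.Torus.IsSmooth ρin ∧ FunctionSpaces.Torus.HasZeroMean ρin ∧ ∫ x, ρin x ^ 2 = 1 ∧
    (∀ m, Torus.IsClassicalScalarTransportOn (Icc 0 2) (ν m) (v m) (θ m) ∧ θ m 0 = ρin) ∧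
    (∀ m, ∀ t ∈ Icc (0 : ℝ) 2, FunctionSpaces.Torus.HasZeroMean (θ m t)) ∧
    (∀ m, AntitoneOn (fun t => ∫ x, θ m t x ^ 2) (Icc (0 : ℝ) 2)) ∧
    -- total dissipation anomaly (6.4)
    Tendsto (fun m => ∫ x, θ m 1 x ^ 2) atTop (𝓝 0) ∧
    (∀ s ∈ Ico (0 : ℝ) 1,
      Tendsto (fun m => 2 * ν m * ∫ t in s..1, Torus.scalarGradNormSq (θ m t)) atTop (𝓝 1)) ∧
    -- the inviscid profile (3.8) and (4.5)
    FunctionSpaces.Torus.IsSmoothSpaceTimeOn (Ico 0 1) ρ ∧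
    (∀ T ∈ Ico (0 : ℝ) 1,
      Tendsto (fun m => ⨆ t ∈ Icc (0 : ℝ) T, eLpNorm (θ m t - ρ t) 2 volume) atTop (𝓝 0)) ∧
    -- the forces (3.11), (3.13) and their convergence (p. 10; Bruè–De Lellis Lemma 5.1)
    (∀ t, FunctionSpaces.Torus.IsSmooth (g t)) ∧ Torus.ContinuousInLpOn univ 2 g ∧
    Tendsto (fun m => ⨆ t : ℝ, eLpNorm (Torus.nsBodyForce (ν m) (v m) t - g t) 2 volume)
      atTop (𝓝 0)

end Turb

end Literature.Analysis.FluidPDE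

end
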